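import Mathlib
import Summits.Ventures.PercRepro2.LeafG2Split
import Summits.Ventures.PercRepro2.BHKOutside

/-!
# The one-cluster candidate (STAR) and its link to the «`G2`» grouping (blind cell PercRepro2, p5 g26;
`proofs/P5-OEDGE.md` §33, `proofs/subclaims/S4-HARDSTEP.md` v106)

For a root `s`, avoid sets `X ⊆ Y` and nonnegative monotone functionals `F₁, F₂` of the cluster `C_s`,
write `E_Z[F] = E[F(C_s) 1_{s↮Z}]` (`starMass`) and `S_Z = P(s↮Z)·E_Z[F₁F₂] − E_Z[F₁]·E_Z[F₂]`
(the cleared covariance of `F₁, F₂` under `s ↮ Z`, nonnegative by BHK06 Thm 1.3). The candidate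

  `(STAR)  P(s↮X) · S_Y ≤ P(s↮Y) · S_X`      (`StarKappa p ends s X Y`)

says that the mass-weighted positive association `P(s↮Z)·Cov(F₁, F₂ | s↮Z)` can only DECREASE when the
avoided set grows (equivalently, for `Y = X ∪ {v}`: `Cov(F₁,F₂ | s↮X, v ∈ C_s) ≥ −P(v∉C_s | s↮X)·ΔF₁·ΔF₂`
with `ΔF = E[F | v ∈ C_s] − E[F | v ∉ C_s]`; or `P(F₁F₂, v∈C_s) + P(F₁, v∉C_s)P(F₂, v∉C_s)/P(v∉C_s) ≥ P(F₁)P(F₂)`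
for indicators). It is strictly stronger than BHK06 Thm 1.3 and census-true (P5-OEDGE §33: 1,550 instances
× all up-set pairs, 0 violations; nonnegative tensor-Bernstein coefficients on 14,512 cases). Nothing here
proves it; it is TYPED, and its consequence for row (LEAF-½) is proved:

* `starL_nonneg_of_starKappa`: `StarKappa p ends a₂ {a₁} {a₁, v} → 0 ≤ starL` — the cleared (STAR)
  statement for the two `C₁`-events `b ∈ C₁`, `o ∈ C₁` (`LeafG2Split.starL`). Proof: explore `C₂`; the
  functionals `F₁ = 1 − g_b`, `F₂ = 1 − g_o` with `g_x(W) = P(x ∈ C_{a₁} in G ∖ W)` (`outsideProb`) are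
  monotone and nonnegative; the tower identities turn `E_Z[F_i]` into event masses
  (`prob_outside_inter_avoid_eq_expect`), and the difference of the two second moments is controlled by
  Harris on `G ∖ C₂` restricted to the event `v ∈ C₂` (`expect_outside_mul_conn_le_prob`, the restricted
  form of `expect_outside_mul_le_prob`): `starL = [the (STAR) slack] + P(s↮X)·P(s↮Y)·[Harris part on v ∈ C₂]`.
* Hence (`LeafRow_of_starKappa_g2one`) row (LEAF-½) follows from `StarKappa` at the two roots and the two
  `g2one` statements.
-/

namespace Summit.Ventures.PercRepro2

open UnionCluster CovForm PendantRoot LeafStep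

section StarDef

variable {V : Type*} {E : Type*} [Fintype E] [DecidableEq E]
  {R : Type*} [Field R] [LinearOrder R] [IsStrictOrderedRing R]

/-- **Cluster mass under avoidance**: `E[F(C_s) · 1_{s ↮ X}]`. -/
noncomputable def starMass (p : E → R) (ends : E → Sym2 V) (s : V) (X : Finset V)
    (F : Set V → R) : R :=
  expect p (fun ω => F (cluster ends ω s) * (avoidAll ends s X).indicator 1 ω)

/-- **The candidate (STAR)** for the root `s` and the avoid sets `X ⊆ Y` (intended: `Y = X ∪ {v}`): for all
nonnegative monotone cluster functionals `F₁, F₂`,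
`P(s↮X) · [P(s↮Y)·E_Y[F₁F₂] − E_Y[F₁]·E_Y[F₂]] ≤ P(s↮Y) · [P(s↮X)·E_X[F₁F₂] − E_X[F₁]·E_X[F₂]]`
(the mass-weighted covariance of `F₁, F₂` under `s ↮ Z` is antitone in `Z`). A CANDIDATE, not a theorem. -/
def StarKappa (p : E → R) (ends : E → Sym2 V) (s : V) (X Y : Finset V) : Prop :=
  ∀ (F₁ F₂ : Set V → R), Monotone F₁ → Monotone F₂ → (∀ S, 0 ≤ F₁ S) → (∀ S, 0 ≤ F₂ S) →
    prob p (avoidAll ends s X) *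
        (prob p (avoidAll ends s Y) * starMass p ends s Y (F₁ * F₂) -
          starMass p ends s Y F₁ * starMass p ends s Y F₂) ≤
      prob p (avoidAll ends s Y) *
        (prob p (avoidAll ends s X) * starMass p ends s X (F₁ * F₂) -
          starMass p ends s X F₁ * starMass p ends s X F₂)

end StarDef

section RestrictedHarris

variable {V : Type*} {E : Type*} [Fintype E] [DecidableEq E] [Fintype V] [DecidableEq V]
  {R : Type*} [CommRing R] [LinearOrder R] [IsStrictOrderedRing R]

/-- **Exploring the cluster of `s`, two outside events, restricted to `w ∈ C_s`** (Harris on `G ∖ C_s`,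
fibre by fibre): `E[g_u(C_s) · g_{u'}(C_s) · 1_{s↮X} · 1_{w ∈ C_s}] ≤ P(C_u ∈ 𝓤, C_{u'} ∈ 𝓥, s ↮ X ∪ {u, u'}, w ∈ C_s)`
— `expect_outside_mul_le_prob` with the extra cluster indicator `1_{w ∈ C_s}`. -/
theorem expect_outside_mul_conn_le_prob {p : E → R} (hp : IsProbVec p) (ends : E → Sym2 V)
    (s u u' w : V) (X : Finset V) {𝓤 𝓥 : Set (Set V)} (h𝓤 : IsUpperSet 𝓤) (h𝓥 : IsUpperSet 𝓥) :
    expect p (fun ω => outsideProb p ends u 𝓤 (cluster ends ω s) *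
        outsideProb p ends u' 𝓥 (cluster ends ω s) * (avoidAll ends s X).indicator 1 ω *
        (connEvent ends s w).indicator 1 ω) ≤
      prob p (clusterInEvent ends u 𝓤 ∩ clusterInEvent ends u' 𝓥 ∩
        avoidAll ends s (insert u (insert u' X)) ∩ connEvent ends s w) := by
  classical
  -- `𝓐` describes `{s ↮ X ∪ {u, u'}} ∩ {w ∈ C_s}` through the cluster of `s`
  let 𝓐 : Set (Set V) := {W | ((∀ x ∈ X, x ∉ W) ∧ u ∉ W ∧ u' ∉ W) ∧ w ∈ W}
  have hA : ∀ ω, ω ∈ avoidAll ends s (insert u (insert u' X)) ∩ connEvent ends s w ↔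
      cluster ends ω s ∈ 𝓐 := by
    intro ω
    rw [Set.mem_inter_iff, mem_avoidAll_insert_iff, mem_avoidAll_insert_iff,
      connEvent_eq_clusterInEvent ends s w, mem_clusterInEvent]
    simp only [𝓐, Set.mem_setOf_eq, mem_avoidAll, mem_cluster]
    tauto
  let c : Set V → R := fun W => 𝓐.indicator 1 W
  let D : Set V → Config E → R := fun W =>
    ({ω | cluster ends (delConfig ends W ω) u ∈ 𝓤} ∩
      {ω | cluster ends (delConfig ends W ω) u' ∈ 𝓥} : Set (Config E)).indicator 1
  let Φ : Set V → Config E → R := fun W ω => c W * D W ω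
  have hΦ : ∀ W, DependsOn (Φ W) (touches ends W)ᶜ := by
    intro W ω ω' h
    simp only [Φ, D]
    congr 1
    refine dependsOn_indicator (R := R) (fun ω ω' h => ?_) h
    show (cluster ends (delConfig ends W ω) u ∈ 𝓤 ∧ cluster ends (delConfig ends W ω) u' ∈ 𝓥) =
      (cluster ends (delConfig ends W ω') u ∈ 𝓤 ∧ cluster ends (delConfig ends W ω') u' ∈ 𝓥)
    rw [delConfig_congr h]
  have hS : ∀ W : Set V, DependsOn (· ∈ {ω | cluster ends ω s = W}) (touches ends W) :=
    fun W => dependsOn_clusterEvent ends s W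
  have hdisj : ∀ W : Set V, Disjoint (touches ends W) (touches ends W)ᶜ :=
    fun W => disjoint_compl_right
  -- pointwise: the indicator of the event is `Φ (C_s ω) ω`
  have hpt : ∀ ω, (clusterInEvent ends u 𝓤 ∩ clusterInEvent ends u' 𝓥 ∩
      avoidAll ends s (insert u (insert u' X)) ∩ connEvent ends s w).indicator (1 : Config E → R) ω =
      Φ (cluster ends ω s) ω := by
    intro ω
    simp only [Φ, c, D]
    by_cases hav : ω ∈ avoidAll ends s (insert u (insert u' X)) ∩ connEvent ends s w
    · have hav' := (hA ω).1 hav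
      have hav'' : ω ∈ avoidAll ends s (insert u (insert u' X)) := hav.1
      have hw : ω ∈ connEvent ends s w := hav.2
      have eu := cluster_delConfig_cluster (ends := ends) (ω := ω) (s := s) hav'.1.2.1
      have ev := cluster_delConfig_cluster (ends := ends) (ω := ω) (s := s) hav'.1.2.2
      simp only [Set.indicator_apply, Set.mem_inter_iff, Set.mem_setOf_eq, mem_clusterInEvent, eu,
        ev, hav'', hw, hav', and_true, if_true, Pi.one_apply, one_mul]
    · have h𝓐 : cluster ends ω s ∉ 𝓐 := fun h => hav ((hA ω).2 h)
      have hnot : ω ∉ clusterInEvent ends u 𝓤 ∩ clusterInEvent ends u' 𝓥 ∩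
          avoidAll ends s (insert u (insert u' X)) ∩ connEvent ends s w :=
        fun h => hav ⟨h.1.2, h.2⟩
      simp [Set.indicator_apply, hnot, h𝓐]
  -- the fibre expectation dominates the product of the two outside probabilities
  have hΦexp : ∀ W, c W * (delClusterProb p ends u 𝓤 W * delClusterProb p ends u' 𝓥 W) ≤
      expect p (Φ W) := by
    intro W
    simp only [Φ, D]
    rw [expect_const_mul, ← prob_eq_expect_indicator]
    refine mul_le_mul_of_nonneg_left (delClusterProb_mul_le hp ends u u' h𝓤 h𝓥 W) ?_
    exact Set.indicator_apply_nonneg fun _ => zero_le_one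
  -- pointwise: the integrand is at most `c (C_s ω) · g_u g_{u'} (C_s ω)`
  have hpt2 : ∀ ω, outsideProb p ends u 𝓤 (cluster ends ω s) *
      outsideProb p ends u' 𝓥 (cluster ends ω s) * (avoidAll ends s X).indicator 1 ω *
      (connEvent ends s w).indicator 1 ω ≤
      c (cluster ends ω s) * (delClusterProb p ends u 𝓤 (cluster ends ω s) *
        delClusterProb p ends u' 𝓥 (cluster ends ω s)) := by
    intro ω
    simp only [c]
    by_cases hav : ω ∈ avoidAll ends s (insert u (insert u' X)) ∩ connEvent ends s w
    · have hav' := (hA ω).1 hav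
      have hX : ω ∈ avoidAll ends s X :=
        (mem_avoidAll_insert_iff.1 (mem_avoidAll_insert_iff.1 hav.1).2).2
      rw [Set.indicator_of_mem hav', Set.indicator_of_mem hX, Set.indicator_of_mem hav.2,
        outsideProb_apply_of_notMem p 𝓤 hav'.1.2.1, outsideProb_apply_of_notMem p 𝓥 hav'.1.2.2]
      simp
    · rw [Set.indicator_of_notMem (show cluster ends ω s ∉ 𝓐 from fun h => hav ((hA ω).2 h)),
        zero_mul]
      by_cases hu : u ∈ cluster ends ω s
      · rw [outsideProb_apply_of_mem p 𝓤 hu]; simp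
      by_cases hv : u' ∈ cluster ends ω s
      · rw [outsideProb_apply_of_mem p 𝓥 hv]; simp
      by_cases hw : ω ∈ connEvent ends s w
      · rw [Set.indicator_of_notMem (fun hX => hav ⟨mem_avoidAll_insert_iff.2
          ⟨hu, mem_avoidAll_insert_iff.2 ⟨hv, hX⟩⟩, hw⟩)]
        simp
      · rw [Set.indicator_of_notMem hw]
        simp
  rw [prob_eq_expect_indicator]
  have e1 : (clusterInEvent ends u 𝓤 ∩ clusterInEvent ends u' 𝓥 ∩
      avoidAll ends s (insert u (insert u' X)) ∩ connEvent ends s w).indicator (1 : Config E → R) =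
      fun ω => Φ (cluster ends ω s) ω :=
    funext hpt
  rw [e1, expect_tower p hdisj (S := fun ω => cluster ends ω s) hS hΦ]
  unfold expect
  refine Finset.sum_le_sum fun ω _ => ?_
  refine mul_le_mul_of_nonneg_left ((hpt2 ω).trans (hΦexp _)) (weight_nonneg hp ω)

end RestrictedHarris

section Link

open LeafHalfCross

variable {V : Type*} {E : Type*} [Fintype E] [DecidableEq E] [Fintype V] [DecidableEq V]
  {R : Type*} [Field R] [LinearOrder R] [IsStrictOrderedRing R]

variable (p : E → R) (ends : E → Sym2 V)

/-- `g_x(W) = 1[a₁ ∉ W] · P(x ∈ C_{a₁} in G ∖ W)` — the outside functional of the mark `x` for the root `a₁`. -/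
noncomputable def outL (a₁ x : V) : Set V → R := outsideProb p ends a₁ {W : Set V | x ∈ W}

/-- `E[g_b(C_{a₂}) · g_o(C_{a₂}) · 1_{a₂ ↮ Z}]` — the second moment of the two outside functionals. -/
noncomputable def secondMoment (a₁ a₂ b o : V) (Z : Finset V) : R :=
  expect p (fun ω => outL p ends a₁ b (cluster ends ω a₂) * outL p ends a₁ o (cluster ends ω a₂) *
    (avoidAll ends a₂ Z).indicator 1 ω)

omit [Fintype V] [DecidableEq V] in
/-- `1 − g_x` is monotone. -/
lemma monotone_one_sub_outL (hp : IsProbVec p) (a₁ x : V) :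
    Monotone (fun W => (1 : R) - outL p ends a₁ x W) := by
  intro W W' h
  have := outsideProb_anti hp ends a₁ (isUpperSet_mem_setOf x) h
  simp only [outL]
  linarith

omit [Fintype V] [DecidableEq V] in
/-- `0 ≤ 1 − g_x`. -/
lemma one_sub_outL_nonneg (hp : IsProbVec p) (a₁ x : V) (W : Set V) :
    0 ≤ (1 : R) - outL p ends a₁ x W := by
  have := outsideProb_le_one hp ends a₁ {W : Set V | x ∈ W} W
  simp only [outL]
  linarith

omit [LinearOrder R] [IsStrictOrderedRing R] in
/-- **Tower identity for one mark**: `E[(1 − g_x)(C_{a₂}) 1_{a₂↮Z}] = P(a₂↮Z) − P(a₂↮Z, x ∈ C_{a₁})` for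
`a₁ ∈ Z`. -/
lemma starMass_one_sub_outL (a₁ a₂ x : V) (Z : Finset V) (hZ : a₁ ∈ Z) :
    starMass p ends a₂ Z (fun W => (1 : R) - outL p ends a₁ x W) =
      prob p (avoidAll ends a₂ Z) - prob p (avoidAll ends a₂ Z ∩ connEvent ends a₁ x) := by
  have h := prob_outside_inter_avoid_eq_expect p ends a₂ a₁ Z {W : Set V | x ∈ W}
  rw [Finset.insert_eq_of_mem hZ, ← connEvent_eq_clusterInEvent ends a₁ x, Set.inter_comm] at h
  rw [h, prob_eq_expect_indicator p (avoidAll ends a₂ Z), ← expect_sub]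
  unfold starMass outL
  congr 1
  funext ω
  simp only [Pi.sub_apply]
  ring

omit [LinearOrder R] [IsStrictOrderedRing R] in
/-- **Tower identity for the product**: `E[(1 − g_b)(1 − g_o)(C_{a₂}) 1_{a₂↮Z}]
= P(a₂↮Z) − P(a₂↮Z, b ∈ C₁) − P(a₂↮Z, o ∈ C₁) + E[g_b g_o 1_{a₂↮Z}]` for `a₁ ∈ Z`. -/
lemma starMass_mul_one_sub_outL (a₁ a₂ b o : V) (Z : Finset V) (hZ : a₁ ∈ Z) :
    starMass p ends a₂ Z
        ((fun W => (1 : R) - outL p ends a₁ b W) * (fun W => (1 : R) - outL p ends a₁ o W)) =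
      prob p (avoidAll ends a₂ Z) - prob p (avoidAll ends a₂ Z ∩ connEvent ends a₁ b) -
        prob p (avoidAll ends a₂ Z ∩ connEvent ends a₁ o) + secondMoment p ends a₁ a₂ b o Z := by
  have hb := prob_outside_inter_avoid_eq_expect p ends a₂ a₁ Z {W : Set V | b ∈ W}
  have ho := prob_outside_inter_avoid_eq_expect p ends a₂ a₁ Z {W : Set V | o ∈ W}
  rw [Finset.insert_eq_of_mem hZ, ← connEvent_eq_clusterInEvent ends a₁ b, Set.inter_comm] at hb
  rw [Finset.insert_eq_of_mem hZ, ← connEvent_eq_clusterInEvent ends a₁ o, Set.inter_comm] at ho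
  rw [hb, ho, prob_eq_expect_indicator p (avoidAll ends a₂ Z)]
  unfold secondMoment starMass
  rw [← expect_sub, ← expect_sub, ← expect_add]
  congr 1
  funext ω
  simp only [Pi.mul_apply, Pi.sub_apply, Pi.add_apply, outL]
  ring

omit [Fintype E] [DecidableEq E] [Fintype V] [LinearOrder R] [IsStrictOrderedRing R] in
/-- `1_{a₂ ↮ {a₁}} · 1_{v ∈ C₂} = 1_{a₂ ↮ {a₁}} − 1_{a₂ ↮ {a₁, v}}` pointwise. -/
lemma indicator_Q_mul_conn (a₁ a₂ v : V) (ω : Config E) :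
    (avoidAll ends a₂ {a₁}).indicator (1 : Config E → R) ω * (connEvent ends a₂ v).indicator 1 ω =
      (avoidAll ends a₂ {a₁}).indicator 1 ω - (avoidAll ends a₂ {a₁, v}).indicator 1 ω := by
  rw [avoidAll_pair_eq_Q_inter]
  by_cases hQ : ω ∈ avoidAll ends a₂ {a₁}
  · by_cases hv : ω ∈ connEvent ends a₂ v
    · rw [Set.indicator_of_mem hQ, Set.indicator_of_mem hv,
        Set.indicator_of_notMem (show ω ∉ avoidAll ends a₂ {a₁} ∩ (connEvent ends a₂ v)ᶜ from
          fun h => h.2 hv)]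
      simp
    · rw [Set.indicator_of_mem hQ, Set.indicator_of_notMem hv,
        Set.indicator_of_mem (show ω ∈ avoidAll ends a₂ {a₁} ∩ (connEvent ends a₂ v)ᶜ from ⟨hQ, hv⟩)]
      simp
  · rw [Set.indicator_of_notMem hQ,
      Set.indicator_of_notMem (show ω ∉ avoidAll ends a₂ {a₁} ∩ (connEvent ends a₂ v)ᶜ from
        fun h => hQ h.1)]
    simp

/-- **The restricted Harris bound in the two-root vocabulary**:
`E[g_b g_o 1_Q] − E[g_b g_o 1_{a₂↮{a₁,v}}] ≤ P(Q, vH, oL, bL)`. -/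
theorem secondMoment_sub_le (hp : IsProbVec p) (o a₁ a₂ v b : V) :
    secondMoment p ends a₁ a₂ b o {a₁} - secondMoment p ends a₁ a₂ b o {a₁, v} ≤
      mHLL p ends a₁ a₂ v o b := by
  have h := expect_outside_mul_conn_le_prob hp ends a₂ a₁ a₁ v {a₁} (isUpperSet_mem_setOf b)
    (isUpperSet_mem_setOf o)
  rw [Finset.insert_eq_of_mem (Finset.mem_singleton_self a₁),
    Finset.insert_eq_of_mem (Finset.mem_singleton_self a₁), ← connEvent_eq_clusterInEvent ends a₁ b,
    ← connEvent_eq_clusterInEvent ends a₁ o] at h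
  -- the left side is the difference of the two second moments
  have hl : expect p (fun ω => outsideProb p ends a₁ {W : Set V | b ∈ W} (cluster ends ω a₂) *
      outsideProb p ends a₁ {W : Set V | o ∈ W} (cluster ends ω a₂) *
      (avoidAll ends a₂ {a₁}).indicator 1 ω * (connEvent ends a₂ v).indicator 1 ω) =
      secondMoment p ends a₁ a₂ b o {a₁} - secondMoment p ends a₁ a₂ b o {a₁, v} := by
    unfold secondMoment
    rw [← expect_sub]
    congr 1
    funext ω
    simp only [Pi.sub_apply, outL]
    rw [mul_assoc, indicator_Q_mul_conn]
    ring
  -- the right side is the difference of the two masses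
  have hr : prob p (connEvent ends a₁ b ∩ connEvent ends a₁ o ∩ avoidAll ends a₂ {a₁} ∩
      connEvent ends a₂ v) = mHLL p ends a₁ a₂ v o b := by
    have h2 := prob_inter_add_prob_inter_compl p
      (connEvent ends a₁ b ∩ connEvent ends a₁ o ∩ avoidAll ends a₂ {a₁}) (connEvent ends a₂ v)
    have e1 : connEvent ends a₁ b ∩ connEvent ends a₁ o ∩ avoidAll ends a₂ {a₁} =
        avoidAll ends a₂ {a₁} ∩ (connEvent ends a₁ o ∩ connEvent ends a₁ b) := by
      ext ω; simp only [Set.mem_inter_iff]; tauto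
    have e2 : connEvent ends a₁ b ∩ connEvent ends a₁ o ∩ avoidAll ends a₂ {a₁} ∩
        (connEvent ends a₂ v)ᶜ = avoidAll ends a₂ {a₁} ∩
        (connEvent ends a₁ o ∩ connEvent ends a₁ b) ∩ (connEvent ends a₂ v)ᶜ := by
      rw [e1]
    have e3 : avoidAll ends a₂ {a₁} ∩ (connEvent ends a₁ o ∩ connEvent ends a₁ b) ∩
        (connEvent ends a₂ v)ᶜ = (connEvent ends a₁ o ∩ connEvent ends a₁ b) ∩
        avoidAll ends a₂ {a₁, v} := by
      rw [avoidAll_pair_eq_Q_inter]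
      ext ω; simp only [Set.mem_inter_iff, Set.mem_compl_iff]; tauto
    rw [e2, e3, prob_inter_avoidAll_pair] at h2
    have e4 : prob p (connEvent ends a₁ b ∩ connEvent ends a₁ o ∩ avoidAll ends a₂ {a₁}) =
        prob p (avoidAll ends a₂ {a₁} ∩ (connEvent ends a₁ o ∩ connEvent ends a₁ b)) := by rw [e1]
    unfold mHLL
    linarith
  rw [hl, hr] at h
  exact h

/-- **(STAR) at `(a₂; {a₁} ⊆ {a₁, v})` gives `0 ≤ starL`** — the cleared conditional-share statement for
the two `C₁`-events `b ∈ C₁`, `o ∈ C₁` (`LeafG2Split.starL`) follows from the candidate `StarKappa`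
applied to `F₁ = 1 − g_b`, `F₂ = 1 − g_o`, plus Harris on `G ∖ C₂` restricted to `v ∈ C₂`:
`starL = [P(Q)·S_Y-slack] + P(Q)·P(a₂↮{a₁,v})·[the Harris part on v ∈ C₂]`. -/
theorem starL_nonneg_of_starKappa (hp : IsProbVec p) (o a₁ a₂ v b : V)
    (hstar : StarKappa p ends a₂ {a₁} {a₁, v}) : 0 ≤ LeafHalfCross.starL p ends o a₁ a₂ v b := by
  have hX : a₁ ∈ ({a₁} : Finset V) := Finset.mem_singleton_self a₁
  have hY : a₁ ∈ ({a₁, v} : Finset V) := Finset.mem_insert_self a₁ {v}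
  have h := hstar (fun W => (1 : R) - outL p ends a₁ b W) (fun W => (1 : R) - outL p ends a₁ o W)
    (monotone_one_sub_outL p ends hp a₁ b) (monotone_one_sub_outL p ends hp a₁ o)
    (one_sub_outL_nonneg p ends hp a₁ b) (one_sub_outL_nonneg p ends hp a₁ o)
  rw [starMass_mul_one_sub_outL p ends a₁ a₂ b o {a₁} hX,
    starMass_mul_one_sub_outL p ends a₁ a₂ b o {a₁, v} hY,
    starMass_one_sub_outL p ends a₁ a₂ b {a₁} hX, starMass_one_sub_outL p ends a₁ a₂ o {a₁} hX,
    starMass_one_sub_outL p ends a₁ a₂ b {a₁, v} hY,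
    starMass_one_sub_outL p ends a₁ a₂ o {a₁, v} hY] at h
  have hH := secondMoment_sub_le p ends hp o a₁ a₂ v b
  -- the `Y`-world masses in `Q`-masses
  have eY : prob p (avoidAll ends a₂ {a₁, v}) = mQ p ends a₁ a₂ - mH p ends a₁ a₂ v := by
    unfold mQ mH; exact prob_avoidAll_pair p ends a₁ a₂ v
  have eBY : prob p (avoidAll ends a₂ {a₁, v} ∩ connEvent ends a₁ b) =
      mL p ends a₁ a₂ b - mHL p ends a₁ a₂ v b := by
    unfold mL mHL; rw [Set.inter_comm]; exact prob_inter_avoidAll_pair p ends _ a₁ a₂ v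
  have eLY : prob p (avoidAll ends a₂ {a₁, v} ∩ connEvent ends a₁ o) =
      mL p ends a₁ a₂ o - mHL p ends a₁ a₂ v o := by
    unfold mL mHL; rw [Set.inter_comm]; exact prob_inter_avoidAll_pair p ends _ a₁ a₂ v
  have eQ : prob p (avoidAll ends a₂ {a₁}) = mQ p ends a₁ a₂ := rfl
  have eB : prob p (avoidAll ends a₂ {a₁} ∩ connEvent ends a₁ b) = mL p ends a₁ a₂ b := rfl
  have eL : prob p (avoidAll ends a₂ {a₁} ∩ connEvent ends a₁ o) = mL p ends a₁ a₂ o := rfl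
  rw [eY, eBY, eLY, eQ, eB, eL] at h
  have hQ0 : 0 ≤ mQ p ends a₁ a₂ := prob_nonneg hp _
  have hW0 : 0 ≤ mQ p ends a₁ a₂ - mH p ends a₁ a₂ v := W_nonneg p ends hp a₁ a₂ v
  -- starL = [the (STAR) slack] + P(Q)·W·[(BL_X − M_X) − (BL_Y − M_Y)]
  unfold LeafHalfCross.starL
  set Q := mQ p ends a₁ a₂
  set Vm := mH p ends a₁ a₂ v
  set B := mL p ends a₁ a₂ b
  set L := mL p ends a₁ a₂ o
  set BV := mHL p ends a₁ a₂ v b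
  set LV := mHL p ends a₁ a₂ v o
  set BL := mLL p ends a₁ a₂ o b
  set BLV := mHLL p ends a₁ a₂ v o b
  set MX := secondMoment p ends a₁ a₂ b o {a₁}
  set MY := secondMoment p ends a₁ a₂ b o {a₁, v}
  have key : (Q - Vm) * (Q * BL - B * L) - Q * ((Q - Vm) * (BL - BLV) - (B - BV) * (L - LV)) =
      ((Q - Vm) * (Q * (Q - B - L + MX) - (Q - B) * (Q - L)) -
        Q * ((Q - Vm) * ((Q - Vm) - (B - BV) - (L - LV) + MY) - ((Q - Vm) - (B - BV)) * ((Q - Vm) - (L - LV)))) +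
      Q * (Q - Vm) * (BLV - (MX - MY)) := by ring
  rw [key]
  have hslack : 0 ≤ (Q - Vm) * (Q * (Q - B - L + MX) - (Q - B) * (Q - L)) -
      Q * ((Q - Vm) * ((Q - Vm) - (B - BV) - (L - LV) + MY) - ((Q - Vm) - (B - BV)) * ((Q - Vm) - (L - LV))) := by
    linarith
  have hharris : 0 ≤ Q * (Q - Vm) * (BLV - (MX - MY)) :=
    mul_nonneg (mul_nonneg hQ0 hW0) (by linarith)
  linarith

/-- **Row (LEAF-½) from (STAR) at both roots and the two `g2one` statements.** -/
theorem LeafRow_of_starKappa_g2one (hp : IsProbVec p) (o a₁ a₂ v b : V)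
    (hL : StarKappa p ends a₂ {a₁} {a₁, v}) (hH : StarKappa p ends a₁ {a₂} {a₂, v})
    (gL : 0 ≤ g2one p ends o a₁ a₂ v b) (gH : 0 ≤ g2one p ends o a₂ a₁ v b) :
    LeafRow p ends o a₁ a₂ v b :=
  LeafRow_of_star_g2one p ends hp o a₁ a₂ v b (starL_nonneg_of_starKappa p ends hp o a₁ a₂ v b hL) gL
    (starL_nonneg_of_starKappa p ends hp o a₂ a₁ v b hH) gH

end Link

end Summit.Ventures.PercRepro2

/-! ## ERRATUM (p5 g26, 2026-08-28T16:3xZ, STATUS 10362 / 10390) — `StarKappa` is FALSE in general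

`StarKappa p ends s X Y` fails for the plain cluster (`X = ∅`) of the vertex `4` on the five-vertex graph with edges
`03 13 14 23 24 34` and weights `(1/64, 1/16, 15/16, 1/2, 1/2, 63/64)`, `Y = {0}`, `F₁ = 1{1 ∈ ·}`, `F₂ = 1{2 ∈ ·}`
(cleared slack `−276207523/5912009598042112`), and — by `starL_nonneg_of_starKappa` read backwards — for
`s = 1`, `X = {2}`, `Y = {2, 6}` on `E = {01, 02, 05, 14, 15, 24, 26, 34, 35, 56}`, `p = (63, 63, 1, 59, 63, 36, 63, 62, 32, 1)/64`,
where `starL < 0` with `(a₁, a₂, b, o, v) = (2, 1, 4, 0, 6)`. The theorems of this file stand as stated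
(`expect_outside_mul_conn_le_prob` is unconditional; `starL_nonneg_of_starKappa` and `LeafRow_of_starKappa_g2one`
are implications whose hypothesis does not hold in general). The mass-weighted positive association of a cluster is
NOT antitone in the avoided set. -/
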